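import Summits.BirchSwinnertonDyer.Rank1Residual.Iwasawa.UnramifiedConditionFiniteOrbit
import Summits.BirchSwinnertonDyer.Rank1Residual.Iwasawa.InertiaCohomologyPTorsionFinite
import Literature.NumberTheory.EllipticCurves.GreenbergVatsal2000.NonPrimitiveDatumSelmerInvariants
import Literature.NumberTheory.EllipticCurves.IwasawaNakayamaProofs
import HarnessLib

/-!
# The `p`-torsion of `S^{Σ₀}_A(K_∞)/S_A(K_∞)` is finite (a finite-coset cover), and
# `S^{Σ₀}[𝔪]` is finite once `S[𝔪]` is — Greenberg–Vatsal 2000 §2 p. 20 in the kernel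

HONEST FRAMING (cell `b2b-bsdres`, run/shared/lean/b2b/bsd-rank1-residual/, verbatim in every
file): the goal of the cell is to DELETE the COMBINATION-SHAPED residual classes of the
Birch–Swinnerton-Dyer formula for ALL analytic-rank `≤ 1` elliptic curves over `ℚ` — "full BSD
formula for every rank `≤ 1` curve in class `C`" assembled STRICTLY from published theorems — so
that the rank-`≤ 1` remainder becomes exactly the CONSTRUCTION-SHAPED classes, which are TYPED
(missing-input `Prop`s), NOT attempted. This is not "finishing BSD". Team n1011 (N10/N11; row
T-GV23-PA = the located gap P-α of the A240 derivation): research routes on CONSTRUCTION-SHAPED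
classes; prove what is provable now; no claim beyond stated classes; census output = EVIDENCE,
never a Literature fact; RESIDUAL-MAP marks UNCHANGED; nothing is booked by this file. TOOL
THEOREMS ONLY: no definition, no named fact, nothing cited enters as a hypothesis; the quotient
`S^{Σ₀}/S` is never formed — finiteness is a finite-coset cover.

## What

For a number field `K`, an elliptic curve `E/K`, a prime `p`, a `ℤ_p`-extension `κ` (`H = ker κ`)
with topological generator `γ`, ANY Greenberg data `L` above `p` for `A = E[p^∞]` (no condition on
the lines `C_v`), and a finite set `S₀` of places, write `S^{S₀} = datumSelmerInfty κ A L ↑S₀` and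
`S = datumSelmerInfty κ A L ∅` (Greenberg–Vatsal's `S^{Σ₀}_A(K_∞) ⊇ S_A(K_∞)`, file
`GreenbergVatsal2000.GreenbergSelmerGroups`). Assume every `v ∈ S₀` with `v ∤ p` is finitely
decomposed in `K_∞` (`hD : ∃ δ ∈ D_v, κ δ ≠ 1`; automatic for the CYCLOTOMIC `κ`,
`exists_mem_decomp_apply_ne_one_of_isCyclotomic`).

* `mem_datumSelmerInfty_empty_iff` (§1): `c ∈ S ↔ c ∈ S^{S₀} ∧` (unramified at every place above
  every `v ∈ S₀`, `v ∤ p`) — bookkeeping on the definitions.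
* **`exists_finset_forall_sub_mem_of_nsmul_mem`** (§2): there is a FINITE set `F ⊆ S^{S₀}` such
  that every `s ∈ S^{S₀}` with `p s ∈ S` is congruent to some `f ∈ F` modulo `S` — "the `p`-torsion
  of `S^{Σ₀}/S ↪ ∏_{v ∈ Σ₀} 𝓗_v(K_∞)` is finite" (GV p. 20: "together with the fact that
  `𝓗_ℓ(ℚ_∞)` is `Λ`-cotorsion for `ℓ ≠ p`"). Proof: the map `c ↦ (res_{J_v} conj_{γⁿ} c)_{v, n < p^{m_v}}`
  into the finite product of the finite `p`-torsion sets of `H¹(inertiaIn H v, E[p^∞])`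
  (`finite_setOf_nsmul_eq_zero_discreteH1_inertiaIn`) detects membership in `S`
  (`forall_conjH1_mem_unramifiedKer_of_forall_lt`).
* **`finite_piece_one_nonPrimitive_of_finite_piece_one`** (§3): if `S[𝔪] = {s ∈ S | p s = 0,
  conj_γ s = s}` is finite then so is `S^{S₀}[𝔪]` (the slices of the cover are translates of
  `S[𝔪]`), in the `IwasawaDual.piece` currency of the tree's Nakayama lemma.

Consumer: `DatumSelmerNonPrimitiveInvariants` (END of row T-GV23-PA: `X^{Σ₀}` f.g., torsion,
`μ(X^{Σ₀}) = μ(X)`).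

References: R. Greenberg, V. Vatsal, Invent. Math. 142 (2000) §2 pp. 16–17, 20–21
(arXiv:math/9906215); R. Greenberg, LNM 1716 §1 p. 60.
-/

noncomputable section

open scoped Classical
open NumberField IsDedekindDomain Field CategoryTheory
open Literature.NumberTheory.GaloisRepresentations Literature.NumberTheory.EllipticCurves
  Literature.NumberTheory.EllipticCurves.GreenbergSelmer
  Literature.NumberTheory.EllipticCurves.GreenbergVatsal2000
  Literature.NumberTheory.EllipticCurves.IwasawaDual

universe u

namespace Summit.BirchSwinnertonDyer.Rank1Residual.Iwasawa

/-! ## §1. `S` inside `S^{S₀}`: the extra conditions at `S₀` -/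

section Membership

variable {K : Type u} [Field K] [NumberField K] {p : ℕ} [Fact p.Prime] (κ : ZpExtension K p)
  (M : Type u) [AddCommGroup M] [DistribMulAction (absoluteGaloisGroup K) M] [TopologicalSpace M]
  [DiscreteTopology M] (L : Data K M p)

/-- **`S = S^{S₀} ∩` (unramified above `S₀`)**: a class lies in `S_M(K_∞) = S^{∅}` iff it lies in
`S^{S₀}` and, for every `v ∈ S₀` with `v ∤ p`, all its conjugates die on `H ⊓ I_v` (GV 2000 p. 20:
"`S^{Σ₀}_A(ℚ_∞) = ker (H¹(ℚ_Σ/ℚ_∞, A) → ∏_{ℓ ∈ Σ−Σ₀} 𝓗_ℓ(ℚ_∞))`. Obviously `S_A(ℚ_∞) ⊆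
S^{Σ₀}_A(ℚ_∞)`"). Bookkeeping on `mem_datumSelmer_iff` / `mem_unramifiedOutside_iff`.
[cite: GreenbergVatsal2000, §2 p. 20] -/
theorem mem_datumSelmerInfty_empty_iff (S₀ : Set (HeightOneSpectrum (𝓞 K)))
    (c : subgroupH1 κ.kerSubgroup M) :
    c ∈ datumSelmerInfty κ M L (∅ : Set (HeightOneSpectrum (𝓞 K))) ↔
      c ∈ datumSelmerInfty κ M L S₀ ∧
        ∀ v ∈ S₀, ((p : ℕ) : 𝓞 K) ∉ v.asIdeal → ∀ σ : absoluteGaloisGroup K,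
          conjH1 κ.kerSubgroup M σ c ∈ unramifiedKer κ.kerSubgroup M v := by
  rw [datumSelmerInfty_eq, datumSelmerInfty_eq, mem_datumSelmer_iff, mem_datumSelmer_iff,
    mem_unramifiedOutside_iff, mem_unramifiedOutside_iff]
  constructor
  · rintro ⟨hunr, hp⟩
    exact ⟨⟨fun v _ hpv σ ↦ hunr v (Set.notMem_empty v) hpv σ, hp⟩,
      fun v _ hpv σ ↦ hunr v (Set.notMem_empty v) hpv σ⟩
  · rintro ⟨⟨hunr, hp⟩, hS₀⟩
    refine ⟨fun v _ hpv σ ↦ ?_, hp⟩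
    by_cases hv : v ∈ S₀
    · exact hS₀ v hv hpv σ
    · exact hunr v hv hpv σ

end Membership

/-! ## §2. The `p`-torsion of `S^{S₀}/S` is finite -/

section Cover

variable {K : Type u} [Field K] [NumberField K] (W : WeierstrassCurve K) [W.IsElliptic]
  {p : ℕ} [Fact p.Prime] (κ : ZpExtension K p) {γ : absoluteGaloisGroup K}

/-- **The `p`-torsion of `S^{Σ₀}_A(K_∞)/S_A(K_∞)` is finite** (`A = E[p^∞]`, any Greenberg data
`L`, any finite `S₀` whose members `v ∤ p` are finitely decomposed in `K_∞`), as a finite-coset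
cover: some finite `F ⊆ S^{S₀}` meets every class `s + S` with `s ∈ S^{S₀}`, `p s ∈ S`. GV 2000 §2
p. 20 ("Proposition (2.1), together with the fact that `𝓗_ℓ(ℚ_∞)` is `Λ`-cotorsion for `ℓ ≠ p`")
— here only the injection `S^{Σ₀}/S ↪ ∏_{v ∈ Σ₀} 𝓗_v(K_∞)` and the finiteness of the `p`-torsion
of each `H¹(I_η, E[p^∞])`, `η ∣ v`, finitely many `η` (siblings `UnramifiedConditionFiniteOrbit`,
`InertiaCohomologyPTorsionFinite`). [cite: GreenbergVatsal2000, §2 pp. 17, 20–21] -/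
theorem exists_finset_forall_sub_mem_of_nsmul_mem (hγ : κ.IsTopGenerator γ)
    (L : Data K (W.geomPrimaryTorsion p) p) (S₀ : Finset (HeightOneSpectrum (𝓞 K)))
    (hD : ∀ v ∈ S₀, ((p : ℕ) : 𝓞 K) ∉ v.asIdeal → ∃ δ ∈ decomp (K := K) v, κ δ ≠ 1) :
    ∃ F : Finset ↥(datumSelmerInfty κ (W.geomPrimaryTorsion p) L (↑S₀ : Set (HeightOneSpectrum (𝓞 K)))),
      ∀ s : ↥(datumSelmerInfty κ (W.geomPrimaryTorsion p) L (↑S₀ : Set (HeightOneSpectrum (𝓞 K)))),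
        p • (s : W.subgroupH1 p κ.kerSubgroup) ∈
            datumSelmerInfty κ (W.geomPrimaryTorsion p) L (∅ : Set (HeightOneSpectrum (𝓞 K))) →
          ∃ f ∈ F, (s : W.subgroupH1 p κ.kerSubgroup) - (f : W.subgroupH1 p κ.kerSubgroup) ∈
            datumSelmerInfty κ (W.geomPrimaryTorsion p) L (∅ : Set (HeightOneSpectrum (𝓞 K))) := by
  haveI : κ.kerSubgroup.Normal := by rw [ZpExtension.kerSubgroup]; infer_instance
  set H := κ.kerSubgroup with hH
  set A := W.geomPrimaryTorsion p with hA
  set SS := datumSelmerInfty κ A L (↑S₀ : Set (HeightOneSpectrum (𝓞 K))) with hSS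
  set S := datumSelmerInfty κ A L (∅ : Set (HeightOneSpectrum (𝓞 K))) with hS
  -- the relevant places and, at each, a bound on the number of conjugates to test
  let ι := {v : HeightOneSpectrum (𝓞 K) // v ∈ S₀ ∧ ((p : ℕ) : 𝓞 K) ∉ v.asIdeal}
  haveI : Finite ι := Finite.of_injective (fun i : ι ↦ (⟨i.1, i.2.1⟩ : (↑S₀ : Set _)))
    fun i j hij ↦ Subtype.ext (by simpa using congrArg Subtype.val hij)
  have hrep : ∀ i : ι, ∃ m : ℕ, ∀ σ : absoluteGaloisGroup K, ∃ n < p ^ m, ∃ δ ∈ decomp (K := K) i.1,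
      ∃ h ∈ H, σ = h * (δ * γ ^ n) := fun i ↦ by
    obtain ⟨δ₀, hδ₀, hne⟩ := hD i.1 i.2.1 i.2.2
    exact exists_forall_eq_mul_decomp_mul_pow κ hγ hδ₀ hne
  choose m hm using hrep
  -- the detecting map
  let Φ : W.subgroupH1 p H →+ (Π i : ι, Fin (p ^ m i) → discreteH1 (inertiaIn H i.1) A) :=
    AddMonoidHom.pi fun i ↦ AddMonoidHom.pi fun n ↦
      (resH1Hom (inertiaInToH H i.1) (AddMonoidHom.id A) fun _ _ ↦ rfl).comp
        (conjH1 H A (γ ^ (n : ℕ)))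
  have hΦ : ∀ (c : W.subgroupH1 p H) (i : ι) (n : Fin (p ^ m i)),
      Φ c i n = resH1Hom (inertiaInToH H i.1) (AddMonoidHom.id A) (fun _ _ ↦ rfl)
        (conjH1 H A (γ ^ (n : ℕ)) c) := fun _ _ _ ↦ rfl
  -- (a) `Φ` detects `S` inside `S^{S₀}`
  have hker : ∀ c ∈ SS, Φ c = 0 → c ∈ S := fun c hc h0 ↦ by
    rw [hS, mem_datumSelmerInfty_empty_iff κ A L (↑S₀ : Set _)]
    refine ⟨hc, fun v hv hpv σ ↦ ?_⟩
    refine forall_conjH1_mem_unramifiedKer_of_forall_lt κ A (hm ⟨v, hv, hpv⟩) (fun n hn ↦ ?_) σ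
    have h := congrFun (congrFun h0 ⟨v, hv, hpv⟩) ⟨n, hn⟩
    rw [hΦ] at h
    exact h
  -- (b) on `{s ∈ S^{S₀} | p s ∈ S}` it takes values in a finite set
  let T : Set (W.subgroupH1 p H) := {c | c ∈ SS ∧ p • c ∈ S}
  let P : Set (Π i : ι, Fin (p ^ m i) → discreteH1 (inertiaIn H i.1) A) :=
    {y | ∀ i n, p • y i n = 0}
  have hP : P.Finite := by
    have hfin : ∀ i : ι, Set.Finite {x : discreteH1 (inertiaIn H i.1) A | p • x = 0} := fun i ↦
      finite_setOf_nsmul_eq_zero_discreteH1_inertiaIn W κ i.1 i.2.2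
    refine (Set.Finite.pi' fun i : ι ↦ Set.Finite.pi' fun _ : Fin (p ^ m i) ↦ hfin i).subset ?_
    intro y hy i n
    exact hy i n
  have hTP : Φ '' T ⊆ P := by
    rintro _ ⟨c, ⟨-, hpc⟩, rfl⟩ i n
    rw [← Pi.smul_apply, ← Pi.smul_apply, ← map_nsmul, hΦ]
    have hmem := ((mem_datumSelmerInfty_empty_iff κ A L (↑S₀ : Set _) (p • c)).1 hpc).2 i.1 i.2.1
      i.2.2 (γ ^ (n : ℕ))
    exact hmem
  have hfin : (Φ '' T).Finite := hP.subset hTP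
  -- choose representatives
  have hpre : ∀ y : hfin.toFinset, ∃ c ∈ T, Φ c = y := fun y ↦ by
    have hy := y.2
    rw [Set.Finite.mem_toFinset] at hy
    exact hy
  choose g hgT hgΦ using hpre
  refine ⟨Finset.univ.image fun y ↦ ⟨g y, (hgT y).1⟩, fun s hps ↦ ?_⟩
  have hsT : (s : W.subgroupH1 p H) ∈ T := ⟨s.2, hps⟩
  have hy : Φ s ∈ hfin.toFinset := by
    rw [Set.Finite.mem_toFinset]; exact ⟨_, hsT, rfl⟩
  refine ⟨⟨g ⟨Φ s, hy⟩, (hgT _).1⟩, Finset.mem_image_of_mem _ (Finset.mem_univ _), ?_⟩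
  refine hker _ (SS.sub_mem s.2 (hgT _).1) ?_
  rw [map_sub, hgΦ, sub_self]

end Cover

/-! ## §3. `S[𝔪]` finite ⇒ `S^{S₀}[𝔪]` finite -/

section Pieces

variable {K : Type u} [Field K] [NumberField K] (W : WeierstrassCurve K) [W.IsElliptic]
  {p : ℕ} [Fact p.Prime] (κ : ZpExtension K p) {γ : absoluteGaloisGroup K}

omit [W.IsElliptic] in
/-- Unfolding `conjDatum` on the underlying class (definitional; the sibling lemma in
`NonPrimitiveDatumSelmerInvariants` is private). [folklore] -/
theorem coe_conjDatum_apply' (L : Data K (W.geomPrimaryTorsion p) p)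
    (S₀ : Set (HeightOneSpectrum (𝓞 K))) (γ : absoluteGaloisGroup K)
    (s : datumSelmerInfty κ (W.geomPrimaryTorsion p) L S₀) :
    ((conjDatum W κ L S₀ γ s : datumSelmerInfty κ (W.geomPrimaryTorsion p) L S₀) :
        W.subgroupH1 p κ.kerSubgroup) = W.conjH1 p κ.kerSubgroup γ s :=
  rfl

omit [W.IsElliptic] in
/-- Membership in `S[𝔪] = piece 1` for `ψ = conj_γ − 1`: `p s = 0` and `conj_γ s = s` (on the
underlying classes). [folklore] -/
theorem mem_piece_one_conjDatum_iff (L : Data K (W.geomPrimaryTorsion p) p)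
    (S₀ : Set (HeightOneSpectrum (𝓞 K))) (γ : absoluteGaloisGroup K)
    (s : datumSelmerInfty κ (W.geomPrimaryTorsion p) L S₀) :
    s ∈ piece p (conjDatum W κ L S₀ γ - 1) 1 ↔
      p • (s : W.subgroupH1 p κ.kerSubgroup) = 0 ∧
        W.conjH1 p κ.kerSubgroup γ s = (s : W.subgroupH1 p κ.kerSubgroup) := by
  rw [mem_piece, pow_one, pow_one, IwasawaDual.End_sub_apply, AddMonoid.End.one_apply, sub_eq_zero,
    Subtype.ext_iff, Subtype.ext_iff, AddSubgroupClass.coe_nsmul, ZeroMemClass.coe_zero,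
    coe_conjDatum_apply']

/-- **`S[𝔪]` finite ⇒ `S^{S₀}[𝔪]` finite** (`[𝔪]` = killed by `p` and fixed by `conj_γ`, the
`IwasawaDual.piece … 1` of the tree's Nakayama lemma): an element of `S^{S₀}[𝔪]` has `p s = 0 ∈ S`,
so lies in one of the finitely many classes `f + S` of §2, and two elements of the same class
differ by an element of `S[𝔪]`. With `IsDualPair.module_finite` this is "`X^{Σ₀}` is finitely
generated" (GV 2000 Cor. (2.3), first clause, for `A = E[p^∞]`).
[cite: GreenbergVatsal2000, §2 Cor. (2.3) (arXiv:math/9906215 pp. 20–21)] -/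
theorem finite_piece_one_nonPrimitive_of_finite_piece_one (hγ : κ.IsTopGenerator γ)
    (L : Data K (W.geomPrimaryTorsion p) p) (S₀ : Finset (HeightOneSpectrum (𝓞 K)))
    (hD : ∀ v ∈ S₀, ((p : ℕ) : 𝓞 K) ∉ v.asIdeal → ∃ δ ∈ decomp (K := K) v, κ δ ≠ 1)
    (hfin : (piece p (conjDatum W κ L (∅ : Set (HeightOneSpectrum (𝓞 K))) γ - 1) 1 :
      Set (datumSelmerInfty κ (W.geomPrimaryTorsion p) L (∅ : Set (HeightOneSpectrum (𝓞 K))))).Finite) :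
    (piece p (conjDatum W κ L (↑S₀ : Set (HeightOneSpectrum (𝓞 K))) γ - 1) 1 :
      Set (datumSelmerInfty κ (W.geomPrimaryTorsion p) L (↑S₀ : Set (HeightOneSpectrum (𝓞 K))))).Finite := by
  set A := W.geomPrimaryTorsion p with hA
  set SS := datumSelmerInfty κ A L (↑S₀ : Set (HeightOneSpectrum (𝓞 K))) with hSS
  set S := datumSelmerInfty κ A L (∅ : Set (HeightOneSpectrum (𝓞 K))) with hS
  have hle : S ≤ SS := datumSelmer_mono κ.kerSubgroup A p L (Set.empty_subset _)
  obtain ⟨F, hF⟩ := exists_finset_forall_sub_mem_of_nsmul_mem W κ hγ L S₀ hD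
  -- the slices `A_f = {s ∈ S^{S₀}[𝔪] | s - f ∈ S}`
  have hcover : (piece p (conjDatum W κ L (↑S₀ : Set _) γ - 1) 1 : Set SS) ⊆
      ⋃ f ∈ F, {s : SS | s ∈ piece p (conjDatum W κ L (↑S₀ : Set _) γ - 1) 1 ∧
        (s : W.subgroupH1 p κ.kerSubgroup) - f ∈ S} := by
    intro s hs
    have hps : p • (s : W.subgroupH1 p κ.kerSubgroup) ∈ S := by
      rw [((mem_piece_one_conjDatum_iff W κ L _ γ s).1 hs).1]; exact S.zero_mem
    obtain ⟨f, hfF, hf⟩ := hF s hps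
    exact Set.mem_biUnion hfF ⟨hs, hf⟩
  refine (Set.Finite.biUnion F.finite_toSet fun f _ ↦ ?_).subset hcover
  -- each slice is empty or a translate of (the image of) `S[𝔪]`
  by_cases hne : {s : SS | s ∈ piece p (conjDatum W κ L (↑S₀ : Set _) γ - 1) 1 ∧
      (s : W.subgroupH1 p κ.kerSubgroup) - f ∈ S}.Nonempty
  · obtain ⟨s₀, hs₀, hs₀f⟩ := hne
    refine (hfin.image fun t ↦ s₀ + AddSubgroup.inclusion hle t).subset ?_
    rintro s ⟨hs, hsf⟩
    obtain ⟨hps, hcs⟩ := (mem_piece_one_conjDatum_iff W κ L _ γ s).1 hs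
    obtain ⟨hps₀, hcs₀⟩ := (mem_piece_one_conjDatum_iff W κ L _ γ s₀).1 hs₀
    have hmem : (s : W.subgroupH1 p κ.kerSubgroup) - s₀ ∈ S := by
      have e : (s : W.subgroupH1 p κ.kerSubgroup) - s₀ =
          ((s : W.subgroupH1 p κ.kerSubgroup) - f) - ((s₀ : W.subgroupH1 p κ.kerSubgroup) - f) := by
        abel
      rw [e]; exact S.sub_mem hsf hs₀f
    refine ⟨⟨_, hmem⟩, ?_, ?_⟩
    · rw [SetLike.mem_coe, mem_piece_one_conjDatum_iff]
      refine ⟨?_, ?_⟩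
      · change p • ((s : W.subgroupH1 p κ.kerSubgroup) - s₀) = 0
        rw [smul_sub, hps, hps₀, sub_zero]
      · change W.conjH1 p κ.kerSubgroup γ ((s : W.subgroupH1 p κ.kerSubgroup) - s₀) = _
        rw [map_sub, hcs, hcs₀]
    · apply Subtype.ext
      change (s₀ : W.subgroupH1 p κ.kerSubgroup) + ((s : W.subgroupH1 p κ.kerSubgroup) - s₀) = s
      abel
  · rw [Set.not_nonempty_iff_eq_empty.1 hne]
    exact Set.finite_empty

end Pieces

end Summit.BirchSwinnertonDyer.Rank1Residual.Iwasawa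

end
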